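import Summits.CriticalPhenomena.SAWScalingLimit.Theorems.SubseqIdentification.Negative.NonVacuity
import Summits.CriticalPhenomena.SAWScalingLimit.Theorems.SimpleSubseqLimits.Negative.SimpleSubseqLimitsHonesty
import Summits.CriticalPhenomena.SAWScalingLimit.Theorems.SimpleSubseqLimits.Negative.SimpleSubseqLimitsNecessary

/-!
# Crux `SimpleSubseqLimits` (stmt-CriticalPhenomena-4982): thickened lattice inputs are NECESSARY

Negative-side (tightness-of-the-decomposition) lemmas of the refuter's deep-refute pass on the line
`marked-point-revisit` (gen 2), stated WITHOUT the line's vocabulary so that all three registered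
lines of the crux (`marked-point-revisit`, `past-shadowing-costs-halves`, `capacity-clock-no-plateau`)
can use them.

Every line feeds the crux ONE lattice estimate of the shape
  `(∗)  ∀ θ > 0, ∃ n, limsup_{δ → 0⁺} P_δ[curve ∈ F n] ≤ θ`,
`P_δ = SAW.law D δ (a δ) (b δ)` the critical SAW law, for a decreasing sequence of CLOSED sets
`F n ⊆ CurveClass ℂ` (closed `1/(n+1)`-thickenings of a forbidden configuration: a marked revisit,
a near return to the past, a capacity plateau …) whose intersection contains no class of the crux's
carrier (no simple chord from `a` to `b` in `cl D` meeting `∂D` only at `a, b`). For the picked line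
`F n = closure (nearRevisitEvent z r R₁ R₂ (1/(n+1)))` and `(∗)` is its stub `NoTouchAt`
(the previous pass proved `⋂ₙ F n ∩ simple = ∅` for it, `not_mem_closure_nearRevisitEvent_forall_of_simple`).

* `limsup_law_closed_le_of_weakLimitAlong` — portmanteau along a weakly convergent mesh SEQUENCE for
  closed sets (the laws are finite measures unconditionally, `isFiniteMeasure_law`).
* `exists_limsup_law_le_of_sawScalingLimit` — `(∗)` follows from the summit conjunct (portmanteau
  along `𝓝[>] 0` against the SLE_(8/3) law, which is carried by the crux's carrier,
  `ae_carrier_of_isSLELaw`): no input of shape `(∗)` is over-strong.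
* `exists_limsup_law_le_of_crux` — **`(∗)` follows from the CRUX ITSELF modulo `EventualTight`**
  (stmt-CriticalPhenomena-1372, wanted by all four routes): if `(∗)` failed at level `θ`, meshes
  `δₙ < 1/(n+1)` with `P_{δₙ}[F n] > θ` would carry (Prokhorov, `exists_subseqConv_of_isTightAlongMesh`)
  a subsequential weak limit `ν` with `ν (F m) ≥ θ` for every `m` (portmanteau, `F` decreasing), so
  `ν (⋂ F m) ≥ θ > 0` — but the crux makes `ν` live on the carrier, which misses `⋂ F m`.
  So a lattice input of shape `(∗)` is EXACTLY as strong as (the corresponding part of) the crux in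
  truth value, given tightness: the lines re-express the crux on the lattice, they do not weaken it,
  and no proof of the crux under `EventualTight` can avoid proving every such `(∗)` on the way.
* `exists_limsup_law_le_of_crux_of_not_simple` — the same with the weaker core hypothesis
  `⋂ₙ F n ∩ simple = ∅` (the form the ORDER stubs use).

Refuter drefute (gen 2), crux work dir `Summits/CriticalPhenomena/SAWScalingLimit/Cruxes/SimpleSubseqLimits/`.
-/

noncomputable section

open MeasureTheory Filter Topology Set Metric
open Literature.Probability.RandomPlanarGeometry Literature.Probability.RandomPlanarGeometry.SAW
open Literature.Probability.LatticeModels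
open scoped ENNReal NNReal BoundedContinuousFunction

namespace Summit.CriticalPhenomena.SAWScalingLimit.Theorems.SimpleSubseqLimits.Negative

open Summit.CriticalPhenomena.SAWScalingLimit.Theses.SAWLoopFugacityFlow
  (SimpleSubseqLimits EventualTight)
open Summit.CriticalPhenomena.SAWScalingLimit.Theorems.SubseqIdentification.Negative
  (exists_subseqConv_of_isTightAlongMesh isTightAlongMesh_of_eventualTight)

variable {D : DobrushinDomain} {a b : ℝ → Site 2}

/-- **Portmanteau along a weakly convergent mesh sequence, closed sets.** If the test integrals of
the critical SAW laws along `s` converge to those of a finite measure `ν`, then for every closed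
`F ⊆ CurveClass ℂ`, `limsup_n P_{s n}[curve ∈ F] ≤ ν F` (the laws are finite measures for every
mesh, so no honesty hypothesis is needed). [folklore] -/
theorem limsup_law_closed_le_of_weakLimitAlong {s : ℕ → ℝ} {ν : Measure (CurveClass ℂ)}
    [IsFiniteMeasure ν] (hw : WeakLimitAlong D a b s ν) {F : Set (CurveClass ℂ)}
    (hF : IsClosed F) :
    limsup (fun n => law D.carrier (s n) (a (s n)) (b (s n)) {γ | γ.curve ∈ F}) atTop ≤ ν F := by
  let μs : ℕ → FiniteMeasure (CurveClass ℂ) := fun n =>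
    ⟨(law D.carrier (s n) (a (s n)) (b (s n))).map (fun γ => γ.curve), inferInstance⟩
  let μ : FiniteMeasure (CurveClass ℂ) := ⟨ν, inferInstance⟩
  have hlim : Tendsto μs atTop (𝓝 μ) := by
    rw [FiniteMeasure.tendsto_iff_forall_integral_tendsto]
    intro f
    refine (hw f).congr fun n => ?_
    change _ = ∫ x, f x ∂((law D.carrier (s n) (a (s n)) (b (s n))).map (fun γ => γ.curve))
    rw [integral_map (DomainSAW.measurable_of_top _).aemeasurable
      f.continuous.aestronglyMeasurable]
  have hport := FiniteMeasure.limsup_measure_closed_le_of_tendsto hlim hF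
  refine le_trans (le_of_eq (limsup_congr (Eventually.of_forall fun n => ?_))) hport
  change _ = ((law D.carrier (s n) (a (s n)) (b (s n))).map (fun γ => γ.curve)) F
  rw [Measure.map_apply (DomainSAW.measurable_of_top _) hF.measurableSet]
  rfl

/-- **No thickened lattice input is over-strong: `(∗)` follows from the summit conjunct.** Under
`SAWScalingLimit` (LSW Prediction 1 as typed), for every endpoint approximation, every decreasing
sequence of closed sets `F n` whose intersection contains no carrier class, and every `θ > 0`, some
`F n` has `limsup_{δ → 0⁺} P_δ[curve ∈ F n] ≤ θ`. [folklore] -/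
theorem exists_limsup_law_le_of_sawScalingLimit (h : _root_.SAWScalingLimit)
    (hab : IsEndpointApprox D a b) {F : ℕ → Set (CurveClass ℂ)} (hF : ∀ n, IsClosed (F n))
    (hanti : Antitone F) (hcore : ∀ c : CurveClass ℂ, (∀ n, c ∈ F n) → ¬ Carrier D c)
    {θ : ℝ≥0∞} (hθ : 0 < θ) :
    ∃ n, limsup (fun δ => law D.carrier δ (a δ) (b δ) {γ | γ.curve ∈ F n}) (𝓝[>] (0 : ℝ)) ≤ θ := by
  obtain ⟨Γ, hΓ, -, hT⟩ := h D a b hab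
  haveI : Fact Literature.Probability.Process.isProjectiveLimit_preWienerMeasure :=
    ⟨isProjectiveLimit_preWienerMeasure_holds⟩
  set μ : Measure (CurveClass ℂ) := Literature.Probability.Process.preWienerMeasure.map Γ with hμdef
  have hμ : IsSLELaw ((8 : ℝ≥0) / 3) D μ := ⟨Γ, hΓ, rfl⟩
  haveI := hμ.isProbabilityMeasure
  have hlimF := tendsto_measure_iInter_atTop (μ := μ)
    (fun n : ℕ => (hF n).measurableSet.nullMeasurableSet) hanti ⟨0, measure_ne_top μ _⟩
  have h0 : μ (⋂ n : ℕ, F n) = 0 := by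
    have hae := ae_carrier_of_isSLELaw hμ
    rw [ae_iff] at hae
    exact measure_mono_null (fun c hc hcar => hcore c (mem_iInter.1 hc) hcar) hae
  rw [h0] at hlimF
  obtain ⟨n, hn⟩ := ((tendsto_order.1 hlimF).2 θ hθ).exists
  refine ⟨n, ?_⟩
  let μs : ℝ → FiniteMeasure (CurveClass ℂ) := fun δ =>
    ⟨(law D.carrier δ (a δ) (b δ)).map (fun γ => γ.curve), inferInstance⟩
  let μf : FiniteMeasure (CurveClass ℂ) := ⟨μ, inferInstance⟩
  have hlim : Tendsto μs (𝓝[>] (0 : ℝ)) (𝓝 μf) := by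
    rw [FiniteMeasure.tendsto_iff_forall_integral_tendsto]
    intro f
    have hh := hT f
    rw [← integral_map hΓ.aemeasurable f.continuous.aestronglyMeasurable] at hh
    refine hh.congr fun δ => ?_
    change _ = ∫ x, f x ∂((law D.carrier δ (a δ) (b δ)).map (fun γ => γ.curve))
    rw [integral_map (DomainSAW.measurable_of_top _).aemeasurable
      f.continuous.aestronglyMeasurable]
  have hport := FiniteMeasure.limsup_measure_closed_le_of_tendsto hlim (hF n)
  calc limsup (fun δ => law D.carrier δ (a δ) (b δ) {γ | γ.curve ∈ F n}) (𝓝[>] (0 : ℝ))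
      = limsup (fun δ => ((μs δ : FiniteMeasure (CurveClass ℂ)) : Measure (CurveClass ℂ)) (F n))
          (𝓝[>] (0 : ℝ)) := by
        refine limsup_congr (Eventually.of_forall fun δ => ?_)
        change _ = ((law D.carrier δ (a δ) (b δ)).map (fun γ => γ.curve)) (F n)
        rw [Measure.map_apply (DomainSAW.measurable_of_top _) (hF n).measurableSet]
        rfl
    _ ≤ (μf : Measure (CurveClass ℂ)) (F n) := hport
    _ ≤ θ := hn.le

/-- **NECESSITY PRINCIPLE: `(∗)` follows from the crux itself, modulo `EventualTight`.** If the
pushed-forward critical SAW laws are eventually tight (route item `EventualTight`,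
stmt-CriticalPhenomena-1372) and the crux `SimpleSubseqLimits` holds, then for every endpoint
approximation, every decreasing sequence of closed sets `F n ⊆ CurveClass ℂ` whose intersection
contains no carrier class, and every `θ > 0`, some `F n` has `limsup_{δ → 0⁺} P_δ[curve ∈ F n] ≤ θ`.
Proof: otherwise meshes `δₙ ∈ (0, 1/(n+1))` with `θ < P_{δₙ}[F n]` (`frequently_lt_of_lt_limsup`)
carry a subsequential weak limit `ν` (Prokhorov under tightness), `θ ≤ ν (F m)` for every `m`
(portmanteau for the closed `F m`, monotonicity of `F`), hence `θ ≤ ν (⋂ F m)`; but the crux puts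
`ν` on the carrier, which misses `⋂ F m`. [folklore] -/
theorem exists_limsup_law_le_of_crux (hT : EventualTight) (hS : SimpleSubseqLimits)
    (hab : IsEndpointApprox D a b) {F : ℕ → Set (CurveClass ℂ)} (hF : ∀ n, IsClosed (F n))
    (hanti : Antitone F) (hcore : ∀ c : CurveClass ℂ, (∀ n, c ∈ F n) → ¬ Carrier D c)
    {θ : ℝ≥0∞} (hθ : 0 < θ) :
    ∃ n, limsup (fun δ => law D.carrier δ (a δ) (b δ) {γ | γ.curve ∈ F n}) (𝓝[>] (0 : ℝ)) ≤ θ := by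
  by_contra hcon
  push Not at hcon
  -- meshes `δₙ ∈ (0, 1/(n+1))` with `θ < P_{δₙ}[F n]`
  have hex : ∀ n : ℕ, ∃ δ : ℝ, θ < law D.carrier δ (a δ) (b δ) {γ | γ.curve ∈ F n} ∧
      δ ∈ Ioo (0 : ℝ) (1 / ((n : ℝ) + 1)) := by
    intro n
    have hfr : ∃ᶠ δ in 𝓝[>] (0 : ℝ), θ < law D.carrier δ (a δ) (b δ) {γ | γ.curve ∈ F n} :=
      frequently_lt_of_lt_limsup (by isBoundedDefault) (hcon n)
    exact (hfr.and_eventually (Ioo_mem_nhdsGT (by positivity))).exists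
  choose s hsθ hsI using hex
  have hs : Tendsto s atTop (𝓝[>] (0 : ℝ)) := by
    refine tendsto_nhdsWithin_iff.2 ⟨?_, Eventually.of_forall fun n => (hsI n).1⟩
    exact squeeze_zero (fun n => (hsI n).1.le) (fun n => (hsI n).2.le)
      tendsto_one_div_add_atTop_nhds_zero_nat
  -- a subsequential weak limit along `s` (Prokhorov under `EventualTight`)
  have hT' : Summit.CriticalPhenomena.SAWScalingLimit.Theses.SAWRenewalTightness.EventualTight :=
    fun D a b h => hT D a b h
  obtain ⟨φ, ν, hφ, hν, hlim⟩ :=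
    exists_subseqConv_of_isTightAlongMesh hab (isTightAlongMesh_of_eventualTight hT' hab) hs
  -- the crux: `ν` lives on the carrier
  have hcar : ∀ᵐ c ∂ν, Carrier D c :=
    hS D a b hab (s ∘ φ) ν (hs.comp hφ.tendsto_atTop) hν hlim
  have hw : WeakLimitAlong D a b (s ∘ φ) ν := hlim
  -- portmanteau along the subsequence: `θ ≤ ν (F m)` for every `m`
  have hθle : ∀ m, θ ≤ ν (F m) := by
    intro m
    refine le_trans ?_ (limsup_law_closed_le_of_weakLimitAlong hw (hF m))
    refine le_limsup_of_frequently_le' ?_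
    refine ((eventually_ge_atTop m).mono fun k hk => ?_).frequently
    have hφk : m ≤ φ k := hk.trans (hφ.id_le k)
    calc θ ≤ law D.carrier (s (φ k)) (a (s (φ k))) (b (s (φ k))) {γ | γ.curve ∈ F (φ k)} :=
          (hsθ (φ k)).le
      _ ≤ law D.carrier (s (φ k)) (a (s (φ k))) (b (s (φ k))) {γ | γ.curve ∈ F m} :=
          measure_mono fun γ hγ => hanti hφk hγ
  -- continuity from above: `θ ≤ ν (⋂ F m) = 0`
  have hlimF := tendsto_measure_iInter_atTop (μ := ν)
    (fun n : ℕ => (hF n).measurableSet.nullMeasurableSet) hanti ⟨0, measure_ne_top ν _⟩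
  have hge : θ ≤ ν (⋂ n : ℕ, F n) := ge_of_tendsto' hlimF fun m => hθle m
  have h0 : ν (⋂ n : ℕ, F n) = 0 := by
    rw [ae_iff] at hcar
    exact measure_mono_null (fun c hc hcar' => hcore c (mem_iInter.1 hc) hcar') hcar
  rw [h0] at hge
  exact lt_irrefl _ (hθ.trans_le hge)

/-- The necessity principle with the weaker core hypothesis used by the ORDER stubs: the
intersection of the thickenings contains no SIMPLE class. [folklore] -/
theorem exists_limsup_law_le_of_crux_of_not_simple (hT : EventualTight) (hS : SimpleSubseqLimits)
    (hab : IsEndpointApprox D a b) {F : ℕ → Set (CurveClass ℂ)} (hF : ∀ n, IsClosed (F n))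
    (hanti : Antitone F) (hcore : ∀ c : CurveClass ℂ, (∀ n, c ∈ F n) → c ∉ CurveClass.simple)
    {θ : ℝ≥0∞} (hθ : 0 < θ) :
    ∃ n, limsup (fun δ => law D.carrier δ (a δ) (b δ) {γ | γ.curve ∈ F n}) (𝓝[>] (0 : ℝ)) ≤ θ :=
  exists_limsup_law_le_of_crux hT hS hab hF hanti (fun c hc hcar => hcore c hc hcar.1) hθ

/-- The summit version with the weaker core hypothesis (no simple class in the intersection).
[folklore] -/
theorem exists_limsup_law_le_of_sawScalingLimit_of_not_simple (h : _root_.SAWScalingLimit)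
    (hab : IsEndpointApprox D a b) {F : ℕ → Set (CurveClass ℂ)} (hF : ∀ n, IsClosed (F n))
    (hanti : Antitone F) (hcore : ∀ c : CurveClass ℂ, (∀ n, c ∈ F n) → c ∉ CurveClass.simple)
    {θ : ℝ≥0∞} (hθ : 0 < θ) :
    ∃ n, limsup (fun δ => law D.carrier δ (a δ) (b δ) {γ | γ.curve ∈ F n}) (𝓝[>] (0 : ℝ)) ≤ θ :=
  exists_limsup_law_le_of_sawScalingLimit h hab hF hanti (fun c hc hcar => hcore c hc hcar.1) hθ

end Summit.CriticalPhenomena.SAWScalingLimit.Theorems.SimpleSubseqLimits.Negative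

end
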